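import Literature.NumberTheory.Automorphic.ExteriorSquareNoHeckeEigenvalueGL4
import HarnessLib

/-!
# The Euler-factor identity of the `(2,2)` case of a reducible compatible system attached to a
# cuspidal `π` on `GL₄` with cuspidal exterior square — proofs only

Topic `NumberTheory/Automorphic`; namespace `Literature.NumberTheory.Automorphic`.  PROOFS file
(theorems only: no definition, no named fact, no `sorry`), the `(2,2)` companion of the `(3,1)`
identity `satakePairPolynomial_threeOne_identity` of `ExteriorSquareNoHeckeEigenvalueGL4.lean`.

Let `t = t_{π,v} = {a, b, c, d}` split as `S + T`, `S = {a, b}`, `T = {c, d}`, with `χ = ab`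
(the value at `ϖ_v` of a Hecke character cutting out the plane `S`), `η = cd` and `ℓ = η χ⁻¹`.
The identity of partial `L`-functions used in the `(2,2)` case of A. Shavali, *Irreducibility and
monodromy of automorphic Galois representations of `GL(4)`*, arXiv:2603.19768 (2026), Prop. 4.2
(the `n = 4` analogue of Böckle–Hui, Math. Ann. 393 (2025), §3.2.1),
`L(π × π^∨ ⊗ ℓ) · L(π × π^∨ ⊗ ℓ²) · L(∧²π ⊗ χ⁻¹ℓ)² · ζ · L(ℓ³)
  = L(π × π ⊗ χ⁻¹ℓ) · L(π^∨ × π^∨ ⊗ χℓ²) · L(∧²π ⊗ χ⁻¹) · L(∧²π ⊗ χ⁻¹ℓ²) · L(ℓ) · L(ℓ²)`,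
holds Euler factor by Euler factor: both sides are the Euler polynomial of the same `46`-element
multiset of pair parameters,
`(S⊗S)·{ℓχ⁻¹, ℓ²χ⁻¹} ⊎ (T⊗T)·{χ⁻¹, ℓχ⁻¹} ⊎ (S⊗T)·{χ⁻¹, ℓχ⁻¹ (×4), ℓ²χ⁻¹} ⊎ {1, ℓ, ℓ, ℓ², ℓ², ℓ³}`.
The proof is block bookkeeping: `t⁻¹ = S·χ⁻¹ ⊎ T·η⁻¹` (`{a⁻¹, b⁻¹} = {χ⁻¹ b, χ⁻¹ a}`),
`∧² t = {χ} ⊎ {η} ⊎ S⊗T`, bilinearity of `⊗` (`satakeTensor_add_left/right`,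
`satakeTensor_map_mul_left/right`, `satakeTensor_comm`), fourteen scalar identities in
`χ^{±1}, η^{±1}`, and `abel` on `Multiset ℂ`.

## References

* A. Shavali, arXiv:2603.19768 (2026), Prop. 4.2 (the `(2,2)` case). [Shavali2026GL4]
* G. Böckle, C.-Y. Hui, *Weak abelian direct summands and irreducibility of Galois
  representations*, Math. Ann. 393 (2025), §3.2.1. [BockleHui2025]
-/

noncomputable section

namespace Literature.NumberTheory.Automorphic

/-! ### Multiset bookkeeping -/

/-- Merging two scalings of a multiset: `u · (v · s) = (u v) · s`. [folklore] -/
theorem multiset_map_mul_map_mul (u v : ℂ) (s : Multiset ℂ) :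
    (s.map (v * ·)).map (u * ·) = s.map ((u * v) * ·) := by
  simp only [Multiset.map_map, Function.comp_def, mul_assoc]

/-- **The dual of a `GL₂` parameter is a twist of it**: `{x, y}⁻¹ = (xy)⁻¹ · {x, y}`
(`{x⁻¹, y⁻¹} = {(xy)⁻¹ y, (xy)⁻¹ x}` after a swap). [folklore] -/
theorem pair_map_inv_eq_map_prod_inv_mul {x y : ℂ} (hx : x ≠ 0) (hy : y ≠ 0) :
    ({x, y} : Multiset ℂ).map (·⁻¹) = ({x, y} : Multiset ℂ).map ((x * y)⁻¹ * ·) := by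
  have e1 : (x * y)⁻¹ * x = y⁻¹ := by field_simp
  have e2 : (x * y)⁻¹ * y = x⁻¹ := by field_simp
  simp only [Multiset.insert_eq_cons, Multiset.map_cons, Multiset.map_singleton, e1, e2]
  exact Multiset.cons_swap _ _ _

/-- `∧²{a, b, c, d} = {ab} ⊎ {cd} ⊎ {a, b} ⊗ {c, d}` (the branching
`∧²(S ⊕ T) = ∧²S ⊕ ∧²T ⊕ S ⊗ T` for two planes). [folklore] -/
theorem wedgeTwoParams_four_eq_add_satakeTensor (a b c d : ℂ) :
    wedgeTwoParams ({a, b, c, d} : Multiset ℂ) =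
      {a * b} + {c * d} + satakeTensor {a, b} {c, d} := by
  rw [wedgeTwoParams_four, satakeTensor_pair_pair]
  simp only [Multiset.insert_eq_cons, ← Multiset.singleton_add]
  abel

/-- `{a, b, c, d} = {a, b} + {c, d}`. [folklore] -/
theorem quad_eq_pair_add_pair (a b c d : ℂ) :
    ({a, b, c, d} : Multiset ℂ) = {a, b} + {c, d} := by
  simp only [Multiset.insert_eq_cons, Multiset.cons_add, Multiset.singleton_add]

/-! ### The identity -/

/-- **The `46`-term identity of the `(2,2)` case, factor by factor.**  For `t = {a, b, c, d}` (all
`≠ 0`), `χ = ab`, `ℓ = cd (ab)⁻¹`: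
`P(t, t⁻¹ℓ) P(t, t⁻¹ℓ²) P(∧²t, χ⁻¹ℓ)² P(1, 1) P(ℓ³, 1)
  = P(t, t χ⁻¹ℓ) P(t⁻¹, t⁻¹ χℓ²) P(∧²t, χ⁻¹) P(∧²t, χ⁻¹ℓ²) P(ℓ, 1) P(ℓ², 1)` —
the unramified factors of
`L(π × π^∨ ⊗ ℓ) L(π × π^∨ ⊗ ℓ²) L(∧²π ⊗ χ⁻¹ℓ)² ζ_K L(ℓ³)
  = L(π × π ⊗ χ⁻¹ℓ) L(π^∨ × π^∨ ⊗ χℓ²) L(∧²π ⊗ χ⁻¹) L(∧²π ⊗ χ⁻¹ℓ²) L(ℓ) L(ℓ²)`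
at a place where `t_{π,v} = {a, b} ⊎ {c, d}` with `χ(ϖ_v) = ab` (Shavali 2026, arXiv:2603.19768,
proof of Prop. 4.2; the `(2,2)` twin of `satakePairPolynomial_threeOne_identity`).  Both sides are
the Euler polynomial of
`(S⊗S)·{ℓχ⁻¹, ℓ²χ⁻¹} ⊎ (T⊗T)·{χ⁻¹, ℓχ⁻¹} ⊎ (S⊗T)·{χ⁻¹, 4 × ℓχ⁻¹, ℓ²χ⁻¹} ⊎ {1, ℓ, ℓ, ℓ², ℓ², ℓ³}`,
`S = {a, b}`, `T = {c, d}`. [cite: Shavali2026GL4, Prop. 4.2] -/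
theorem satakePairPolynomial_twoTwo_identity {a b c d : ℂ} (ha : a ≠ 0) (hb : b ≠ 0) (hc : c ≠ 0)
    (hd : d ≠ 0) :
    satakePairPolynomial {a, b, c, d}
          ((({a, b, c, d} : Multiset ℂ).map (·⁻¹)).map (c * d * (a * b)⁻¹ * ·)) *
        satakePairPolynomial {a, b, c, d}
          ((({a, b, c, d} : Multiset ℂ).map (·⁻¹)).map ((c * d * (a * b)⁻¹) ^ 2 * ·)) *
        satakePairPolynomial (wedgeTwoParams {a, b, c, d}) {(a * b)⁻¹ * (c * d * (a * b)⁻¹)} *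
        satakePairPolynomial (wedgeTwoParams {a, b, c, d}) {(a * b)⁻¹ * (c * d * (a * b)⁻¹)} *
        satakePairPolynomial {1} {1} *
        satakePairPolynomial {(c * d * (a * b)⁻¹) ^ 3} {1} =
      satakePairPolynomial {a, b, c, d}
          (({a, b, c, d} : Multiset ℂ).map ((a * b)⁻¹ * (c * d * (a * b)⁻¹) * ·)) *
        satakePairPolynomial (({a, b, c, d} : Multiset ℂ).map (·⁻¹))
          ((({a, b, c, d} : Multiset ℂ).map (·⁻¹)).map (a * b * (c * d * (a * b)⁻¹) ^ 2 * ·)) *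
        satakePairPolynomial (wedgeTwoParams {a, b, c, d}) {(a * b)⁻¹} *
        satakePairPolynomial (wedgeTwoParams {a, b, c, d})
          {(a * b)⁻¹ * (c * d * (a * b)⁻¹) ^ 2} *
        satakePairPolynomial {c * d * (a * b)⁻¹} {1} *
        satakePairPolynomial {(c * d * (a * b)⁻¹) ^ 2} {1} := by
  have hab : a * b ≠ 0 := mul_ne_zero ha hb
  have hcd : c * d ≠ 0 := mul_ne_zero hc hd
  -- the fourteen scalar identities, towards the canonical scalars
  -- `χ⁻¹ = (ab)⁻¹`, `ℓχ⁻¹ = (ab)⁻¹ ℓ`, `ℓ²χ⁻¹ = (ab)⁻¹ ℓ²`, `1`, `ℓ`, `ℓ²`, `ℓ³`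
  have e1 : c * d * (a * b)⁻¹ * (a * b)⁻¹ = (a * b)⁻¹ * (c * d * (a * b)⁻¹) := by ring
  have e2 : c * d * (a * b)⁻¹ * (c * d)⁻¹ = (a * b)⁻¹ := by field_simp
  have e3 : (c * d * (a * b)⁻¹) ^ 2 * (a * b)⁻¹ = (a * b)⁻¹ * (c * d * (a * b)⁻¹) ^ 2 := by ring
  have e4 : (c * d * (a * b)⁻¹) ^ 2 * (c * d)⁻¹ = (a * b)⁻¹ * (c * d * (a * b)⁻¹) := by
    field_simp
  have e5 : (a * b)⁻¹ * (c * d * (a * b)⁻¹) * (a * b) = c * d * (a * b)⁻¹ := by field_simp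
  have e6 : (a * b)⁻¹ * (c * d * (a * b)⁻¹) * (c * d) = (c * d * (a * b)⁻¹) ^ 2 := by ring
  have e7 : a * b * (c * d * (a * b)⁻¹) ^ 2 * (a * b)⁻¹ * (a * b)⁻¹ =
      (a * b)⁻¹ * (c * d * (a * b)⁻¹) ^ 2 := by field_simp
  have e8 : a * b * (c * d * (a * b)⁻¹) ^ 2 * (a * b)⁻¹ * (c * d)⁻¹ =
      (a * b)⁻¹ * (c * d * (a * b)⁻¹) := by field_simp
  have e9 : a * b * (c * d * (a * b)⁻¹) ^ 2 * (c * d)⁻¹ * (a * b)⁻¹ =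
      (a * b)⁻¹ * (c * d * (a * b)⁻¹) := by field_simp
  have e10 : a * b * (c * d * (a * b)⁻¹) ^ 2 * (c * d)⁻¹ * (c * d)⁻¹ = (a * b)⁻¹ := by field_simp
  have e11 : (a * b)⁻¹ * (a * b) = 1 := inv_mul_cancel₀ hab
  have e12 : (a * b)⁻¹ * (c * d) = c * d * (a * b)⁻¹ := mul_comm _ _
  have e13 : (a * b)⁻¹ * (c * d * (a * b)⁻¹) ^ 2 * (a * b) = (c * d * (a * b)⁻¹) ^ 2 := by
    field_simp
  have e14 : (a * b)⁻¹ * (c * d * (a * b)⁻¹) ^ 2 * (c * d) = (c * d * (a * b)⁻¹) ^ 3 := by ring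
  -- products of pair polynomials are the Euler polynomial of the sum of the pair parameters
  simp only [satakePairPolynomial_eq_eulerPolynomial, ← eulerPolynomial_add]
  refine congrArg eulerPolynomial ?_
  -- `∧²t = {χ} ⊎ {η} ⊎ S⊗T`, `t = S ⊎ T`, `t⁻¹ = S·χ⁻¹ ⊎ T·η⁻¹`
  rw [wedgeTwoParams_four_eq_add_satakeTensor, quad_eq_pair_add_pair]
  simp only [Multiset.map_add, pair_map_inv_eq_map_prod_inv_mul ha hb,
    pair_map_inv_eq_map_prod_inv_mul hc hd]
  -- bilinearity: every tensor is a sum of scaled blocks `S⊗S`, `S⊗T`, `T⊗T` and singletons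
  simp only [satakeTensor_add_left, satakeTensor_add_right, satakeTensor_map_mul_left,
    satakeTensor_map_mul_right, multiset_map_mul_map_mul, satakeTensor_comm {c, d} {a, b},
    satakeTensor_singleton_right, Multiset.map_add, Multiset.map_singleton, one_mul]
  rw [e1, e2, e3, e4, e5, e6, e7, e8, e9, e10, e11, e12, e13, e14]
  abel

end Literature.NumberTheory.Automorphic
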